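import Summits.CriticalPhenomena.PercolationContinuityZ3.Theorems.Transplant.GrigorchukPowerSmallParamHolds
import Summits.CriticalPhenomena.PercolationContinuityZ3.Theorems.Transplant.GrigorchukWitnessReturnDecay
import Mathlib.Analysis.MeanInequalitiesPow
import HarnessLib

/-!
# W4 — the `k`-UNIFORM stretched-exponential return decay of the simple random walk on `Cay(𝔊^k; std)`, modulo Woess 2000 Cor. 14.5(b)
# (item E4.2, file a: the input of `UniformPolygons`)

Proof file (`--supports stmt-CriticalPhenomena-4575 --as helper`), lane `prim-bschramm`, seat `prim-bschramm-gen-1` gen 12 (GEN pen); item E4.2 of the lead's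
allocation (lead g29, bus 2026-08-29 #9731; W4 skeleton of record v1.1 98f98c28, stub `stub_uniformPolygons`), FILE a of two, over E4.1 «GrigorchukPowerSmallParamHolds»
(`simpleStep_eq_card_walks_div`, `card_walks_le_pow`), the product formula «GrigorchukPowerWalkProduct» (p688765) and the base return decay «GrigorchukWitnessReturnDecay»
(p688051/p689908, CONDITIONAL on the printed Woess fact `Woess2000_closedWalks_decay_of_growth`, p687849).  builds on p205010 (kernel theorem, internal audit signed;
external expert review pending) — nothing here uses p205010.  Def-free; no instance, no notation, no sorry, no `@[conjecture]`.  NOTHING here claims `θ(p_c) = 0`, an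
infrared bound or the triangle condition on any `Cay(𝔊^k)`; the Woess fact enters ONLY as the hypothesis `hW` of the last two theorems.

THE ARGUMENT.  (§1, generic) The LAZY kernel is the binomial mixture of the SIMPLE one, `p^L_n(x,y) = Σ_{j ≤ n} C(n,j) 2^{−n} p_j(x,y)` (`lazyStep_eq_sum_choose`, Pascal);
on a `d`-regular graph the walks of length `n` from `x` into any finite target set number `≤ dⁿ` (`sum_card_walks_le_pow`); `(Σ_i a_i)^γ ≤ Σ_i a_i^γ` for `0 < γ ≤ 1`
(`rpow_sum_le_sum_rpow`).  (§2) On `Cay(𝔊; a,b,c,d)`: for every `m ≥ 1` some walk of length `m` from `x` does NOT return (the first `m` steps of a geodesic to a vertex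
outside the ball `B(x, m−1)` — `𝔊` is infinite, p594312), so `W_𝔊(m)(x,x) ≤ 4^m − 1` (`card_closedWalks_stdCay_lt_pow`); hence the base decay's constant can be
NORMALISED TO ONE: **`stdCay_closedWalks_decay_normalised (hW) : ∃ c γ, 0 < c ∧ 0 < γ ∧ γ ≤ 1 ∧ ∀ v m, W_𝔊(m)(v,v) ≤ 4^m·exp(−c·m^γ)`** (large `m`: half of Woess's
`C₂`; small `m ≥ 1`: the finitely many ratios `W_𝔊(m)(1,1)/4^m < 1`; `γ ↦ min γ 1`).  (§3) PRODUCT FORMULA (bound form, p688765) with `b(m) = exp(−c m^γ)`: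
`∏_i b(N_i) = exp(−c Σ_i N_i^γ) ≤ exp(−c j^γ)` by subadditivity (`Σ_i N_i = j`), the `k^j` allocations cancel `(4k)^j/4^j`, so
**`simpleStep_gkCay_self_le_exp (hW) : ∃ c γ, 0 < c ∧ 0 < γ ∧ γ ≤ 1 ∧ ∀ k ≥ 1, ∀ v j, p^{(k)}_j(v,v) ≤ exp(−c·j^γ)`** — the return probability of the simple walk on
`Cay(𝔊^k; std)` decays stretched-exponentially with constants FREE OF `k` (the W4 line's `k`-uniformity device: Woess ONCE on the base, transfer through the product
formula).  CONDITIONAL only on `hW`.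
[cite: Woess2000, §1.B, Cor. 14.5(b), Thm. 4.18] [cite: BenjaminiSchramm1996, §2 (Cayley graphs)] [cite: HeydenreichVanDerHofstad2017, §5.2 (random-walk quantities)]
-/

noncomputable section

namespace Summit.CriticalPhenomena.PercolationContinuityZ3.Theorems.Transplant

open SimpleGraph Finset Filter Literature.Probability.MarkovChains Literature.Barriers.CriticalPhenomena

/-! ## §1 Generic: lazy = binomial mixture of simple; walks into a finite target set; subadditivity of `t ↦ t^γ` -/

namespace WalkCount

variable {V : Type*} (G : SimpleGraph V) [DecidableEq V] [G.LocallyFinite]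

/-- **Walks of length `n` from `x` into a finite target set number at most `dⁿ`** on a `d`-regular graph: `Σ_{y ∈ Y} W(n)(x,y) ≤ dⁿ`. [cite: Woess2000, §1.B] -/
theorem sum_card_walks_le_pow {d : ℕ} (hG : G.IsRegularOfDegree d) (n : ℕ) (x : V) (Y : Finset V) :
    ∑ y ∈ Y, Fintype.card {p : G.Walk x y // p.length = n} ≤ d ^ n := by
  induction n generalizing x with
  | zero =>
    simp only [card_walks_zero, pow_zero]
    calc ∑ y ∈ Y, (if x = y then 1 else 0) = (Y.filter fun y => x = y).card := by rw [Finset.card_filter]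
      _ ≤ 1 := Finset.card_le_one.2 fun a ha b hb => by
          rw [Finset.mem_filter] at ha hb; rw [← ha.2, ← hb.2]
  | succ n ih =>
    calc ∑ y ∈ Y, Fintype.card {p : G.Walk x y // p.length = n + 1}
        = ∑ w ∈ G.neighborFinset x, ∑ y ∈ Y, Fintype.card {p : G.Walk w y // p.length = n} := by
          rw [Finset.sum_comm]; exact Finset.sum_congr rfl fun y _ => card_walks_succ G n x y
      _ ≤ ∑ _w ∈ G.neighborFinset x, d ^ n := Finset.sum_le_sum fun w _ => ih w
      _ = d ^ (n + 1) := by rw [Finset.sum_const, card_neighborFinset_eq_degree, hG x, smul_eq_mul, pow_succ, mul_comm]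

end WalkCount

namespace Grigorchuk

namespace NcHaraSlade

open WalkCount
open scoped Classical

/-- **The lazy kernel is the binomial mixture of the simple kernel**: `p^L_n(x, y) = Σ_{j ≤ n} C(n, j)·2^{−n}·p_j(x, y)` (`P_L = (1+P)/2`, Pascal's rule).
[cite: HeydenreichVanDerHofstad2017, §5.2 (random-walk quantities)] -/
theorem lazyStep_eq_sum_choose {V : Type} (G : SimpleGraph V) [G.LocallyFinite] (n : ℕ) (x y : V) :
    lazyStep G n x y = ∑ j ∈ Finset.range (n + 1), ((n.choose j : ℕ) : ℝ) / 2 ^ n * simpleStep G j x y := by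
  induction n generalizing x with
  | zero => simp [lazyStep_zero, simpleStep_zero]
  | succ n ih =>
    rw [lazyStep_succ, ih x]
    simp_rw [ih]
    -- the `P`-term: `Σ_z P(x,z) Σ_j a_j p_j(z,y) = Σ_j a_j p_{j+1}(x,y)`
    have hswap : ∑ z ∈ G.neighborFinset x, 1 / (G.degree x : ℝ) *
        ∑ j ∈ Finset.range (n + 1), ((n.choose j : ℕ) : ℝ) / 2 ^ n * simpleStep G j z y =
        ∑ j ∈ Finset.range (n + 1), ((n.choose j : ℕ) : ℝ) / 2 ^ n * simpleStep G (j + 1) x y := by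
      calc _ = ∑ z ∈ G.neighborFinset x, ∑ j ∈ Finset.range (n + 1),
            1 / (G.degree x : ℝ) * (((n.choose j : ℕ) : ℝ) / 2 ^ n * simpleStep G j z y) := by
            refine Finset.sum_congr rfl fun z _ => ?_
            rw [Finset.mul_sum]
        _ = ∑ j ∈ Finset.range (n + 1), ∑ z ∈ G.neighborFinset x,
            1 / (G.degree x : ℝ) * (((n.choose j : ℕ) : ℝ) / 2 ^ n * simpleStep G j z y) := Finset.sum_comm
        _ = ∑ j ∈ Finset.range (n + 1), ((n.choose j : ℕ) : ℝ) / 2 ^ n *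
            ∑ z ∈ G.neighborFinset x, 1 / (G.degree x : ℝ) * simpleStep G j z y := by
            refine Finset.sum_congr rfl fun j _ => ?_
            rw [Finset.mul_sum]
            refine Finset.sum_congr rfl fun z _ => ?_
            ring
        _ = _ := by
            refine Finset.sum_congr rfl fun j _ => ?_
            rw [← simpleStep_succ]
    rw [hswap]
    -- normal forms of both sides in terms of three sums
    set A : ℝ := ∑ j ∈ Finset.range n, ((n.choose (j + 1) : ℕ) : ℝ) / 2 ^ (n + 1) * simpleStep G (j + 1) x y with hA
    set B : ℝ := ∑ j ∈ Finset.range (n + 1), ((n.choose j : ℕ) : ℝ) / 2 ^ (n + 1) * simpleStep G (j + 1) x y with hB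
    set P0 : ℝ := simpleStep G 0 x y / 2 ^ (n + 1) with hP0
    have h2 : (2 : ℝ) ^ (n + 1) = 2 * 2 ^ n := by rw [pow_succ]; ring
    -- LHS first piece
    have hL1 : (1 / 2 : ℝ) * ∑ j ∈ Finset.range (n + 1), ((n.choose j : ℕ) : ℝ) / 2 ^ n * simpleStep G j x y = A + P0 := by
      rw [Finset.mul_sum, Finset.sum_range_succ', Nat.choose_zero_right, hA, hP0]
      congr 1
      · refine Finset.sum_congr rfl fun j _ => ?_
        rw [h2]; ring
      · rw [h2]; push_cast; ring
    -- LHS second piece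
    have hL2 : (1 / 2 : ℝ) * ∑ j ∈ Finset.range (n + 1), ((n.choose j : ℕ) : ℝ) / 2 ^ n * simpleStep G (j + 1) x y = B := by
      rw [Finset.mul_sum, hB]
      refine Finset.sum_congr rfl fun j _ => ?_
      rw [h2]; ring
    -- RHS
    have hR : ∑ j ∈ Finset.range (n + 1 + 1), (((n + 1).choose j : ℕ) : ℝ) / 2 ^ (n + 1) * simpleStep G j x y = B + A + P0 := by
      rw [Finset.sum_range_succ', Nat.choose_zero_right, hP0]
      have hsplit : ∑ j ∈ Finset.range (n + 1), (((n + 1).choose (j + 1) : ℕ) : ℝ) / 2 ^ (n + 1) * simpleStep G (j + 1) x y = B + A := by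
        have e : ∀ j, (((n + 1).choose (j + 1) : ℕ) : ℝ) / 2 ^ (n + 1) * simpleStep G (j + 1) x y =
            ((n.choose j : ℕ) : ℝ) / 2 ^ (n + 1) * simpleStep G (j + 1) x y +
              ((n.choose (j + 1) : ℕ) : ℝ) / 2 ^ (n + 1) * simpleStep G (j + 1) x y := fun j => by
          rw [Nat.choose_succ_succ, Nat.cast_add]; ring
        rw [Finset.sum_congr rfl fun j _ => e j, Finset.sum_add_distrib, hB, hA]
        congr 1
        rw [Finset.sum_range_succ, Nat.choose_succ_self, Nat.cast_zero, zero_div, zero_mul, add_zero]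
      rw [hsplit]; push_cast; ring
    rw [hL1, hL2, hR]; ring

/-- **Subadditivity of `t ↦ t^γ` on a finite sum** (`0 < γ ≤ 1`, nonnegative terms): `(Σ_i a_i)^γ ≤ Σ_i a_i^γ` (Mathlib's two-term `Real.rpow_add_le_add_rpow`, inducted).
[folklore] -/
theorem rpow_sum_le_sum_rpow {ι : Type*} (s : Finset ι) (a : ι → ℝ) (ha : ∀ i, 0 ≤ a i) {γ : ℝ} (hγ0 : 0 < γ) (hγ1 : γ ≤ 1) :
    (∑ i ∈ s, a i) ^ γ ≤ ∑ i ∈ s, a i ^ γ := by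
  induction s using Finset.induction_on with
  | empty => simp [Real.zero_rpow hγ0.ne']
  | insert i s hi ih =>
    rw [Finset.sum_insert hi, Finset.sum_insert hi]
    exact (Real.rpow_add_le_add_rpow (ha i) (Finset.sum_nonneg fun j _ => ha j) hγ0.le hγ1).trans (add_le_add le_rfl ih)

/-! ## §2 `Cay(𝔊; a,b,c,d)`: a walk of every length leaves, and the base decay with its constant normalised to one -/

/-- **For every `m ≥ 1` and every `x`, some walk of length `m` from `x` in `Cay(𝔊; a,b,c,d)` ends away from `x`** (the first `m` steps of a geodesic from `x` to a vertex
outside the finite ball `B(x, m−1)` of the infinite connected graph). [cite: Grigorchuk1980, Thm. (𝔊 is infinite)] [cite: BenjaminiSchramm1996, §2 (Cayley graphs)] -/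
theorem exists_walk_stdCay_ne (x : ↥grigorchukGroup) (m : ℕ) (hm : 1 ≤ m) :
    ∃ z : ↥grigorchukGroup, z ≠ x ∧ Nonempty {p : stdCay.Walk x z // p.length = m} := by
  -- a vertex outside the ball of radius `m - 1`
  haveI : Infinite ↥grigorchukGroup := Set.infinite_coe_iff.2 grigorchukGroup_infinite
  have hfin := graphBall_finite stdCay x (m - 1)
  obtain ⟨y, hy'⟩ := Infinite.exists_notMem_finset hfin.toFinset
  have hy : y ∉ graphBall stdCay x (m - 1) := fun h => hy' (hfin.mem_toFinset.2 h)
  -- a geodesic to it, of length `≥ m`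
  obtain ⟨p, hp⟩ := stdCay_connected.exists_walk_length_eq_dist x y
  have hlen : m ≤ p.length := by
    by_contra h
    push Not at h
    exact hy ⟨p, by omega⟩
  refine ⟨p.getVert m, fun hz => ?_, ⟨⟨p.take m, by rw [Walk.take_length]; exact Nat.min_eq_left hlen⟩⟩⟩
  -- if the geodesic returned to `x` at time `m`, its tail would be a shorter walk to `y`
  have htail : (p.drop m).length = p.length - m := Walk.drop_length p m
  have hd : stdCay.dist x y ≤ (p.drop m).length := by
    have := SimpleGraph.dist_le ((p.drop m).copy hz rfl)
    rwa [Walk.length_copy] at this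
  omega

/-- **`W_𝔊(m)(x,x) < 4^m` for `m ≥ 1`**: the closed walks miss at least the walk of `exists_walk_stdCay_ne`, among the `≤ 4^m` walks of length `m` from `x` into the two
targets `{x, z}` (`sum_card_walks_le_pow`, `4`-regularity p682867). [cite: Woess2000, §1.B] -/
theorem card_closedWalks_stdCay_lt_pow (x : ↥grigorchukGroup) (m : ℕ) (hm : 1 ≤ m) :
    Fintype.card {p : stdCay.Walk x x // p.length = m} + 1 ≤ 4 ^ m := by
  obtain ⟨z, hz, ⟨w⟩⟩ := exists_walk_stdCay_ne x m hm
  have h1 : 1 ≤ Fintype.card {p : stdCay.Walk x z // p.length = m} := Fintype.card_pos_iff.2 ⟨w⟩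
  have h2 := sum_card_walks_le_pow stdCay (fun u => stdCay_degree u) m x ({x, z} : Finset ↥grigorchukGroup)
  rw [Finset.sum_pair hz.symm] at h2
  omega

/-- **The base return decay with its constant NORMALISED TO ONE** (modulo Woess 2000 Cor. 14.5(b)): `∃ c γ, 0 < c, 0 < γ ≤ 1`, and for EVERY vertex `v` and EVERY
`m`, `W_𝔊(m)(v,v) ≤ 4^m · exp(−c·m^γ)` — from «GrigorchukWitnessReturnDecay» `stdCay_closedWalks_decay_uniform` (`C₁ · 4^m · e^{−C₂ m^γ}`): for `m` beyond a threshold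
half of `C₂` absorbs `C₁`; for the finitely many `1 ≤ m` below it, `W_𝔊(m)(v,v) ≤ W_𝔊(m)(1,1) < 4^m` (`card_closedWalks_stdCay_le_one`, `card_closedWalks_stdCay_lt_pow`)
gives a positive rate; `γ ↦ min γ 1`.  CONDITIONAL only on `hW`. [cite: Woess2000, Cor. 14.5(b), Thm. 4.18] -/
theorem stdCay_closedWalks_decay_normalised (hW : Woess2000_closedWalks_decay_of_growth) :
    ∃ c γ : ℝ, 0 < c ∧ 0 < γ ∧ γ ≤ 1 ∧ ∀ (v : ↥grigorchukGroup) (m : ℕ),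
      (Fintype.card {p : stdCay.Walk v v // p.length = m} : ℝ) ≤ 4 ^ m * Real.exp (-(c * (m : ℝ) ^ γ)) := by
  obtain ⟨γ₀, C₁, C₂, hγ₀, hC₁, hC₂, hdec⟩ := stdCay_closedWalks_decay_uniform hW
  set γ : ℝ := min γ₀ 1 with hγdef
  have hγ : 0 < γ := lt_min hγ₀ one_pos
  have hγ1 : γ ≤ 1 := min_le_right _ _
  -- the uniform bound with exponent `γ` (for `m ≥ 1`, `m^γ ≤ m^γ₀`; at `m = 0` both vanish)
  have hdec' : ∀ (v : ↥grigorchukGroup) (m : ℕ), (Fintype.card {p : stdCay.Walk v v // p.length = m} : ℝ) ≤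
      C₁ * 4 ^ m * Real.exp (-(C₂ * (m : ℝ) ^ γ)) := by
    intro v m
    refine (hdec v m).trans (mul_le_mul_of_nonneg_left (Real.exp_le_exp.2 ?_) (by positivity))
    have hm : (m : ℝ) ^ γ ≤ (m : ℝ) ^ γ₀ := by
      rcases Nat.eq_zero_or_pos m with rfl | hm
      · simp [Real.zero_rpow hγ.ne', Real.zero_rpow hγ₀.ne']
      · exact Real.rpow_le_rpow_of_exponent_le (by exact_mod_cast hm) (min_le_left _ _)
    nlinarith
  -- the threshold `m₀`: for `m ≥ m₀`, `log C₁ ≤ (C₂/2) m^γ`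
  set T : ℝ := (2 * Real.log C₁ / C₂) with hT
  set m₀ : ℕ := ⌈(max T 0) ^ γ⁻¹⌉₊ + 1 with hm₀
  have hlarge : ∀ m : ℕ, m₀ ≤ m → Real.log C₁ ≤ C₂ / 2 * (m : ℝ) ^ γ := by
    intro m hm
    have h1 : (max T 0) ^ γ⁻¹ ≤ (m : ℝ) := by
      have := Nat.le_ceil ((max T 0) ^ γ⁻¹)
      have h2 : (⌈(max T 0) ^ γ⁻¹⌉₊ : ℝ) ≤ (m : ℝ) := by exact_mod_cast (Nat.le_succ _).trans hm
      linarith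
    have h3 : max T 0 ≤ (m : ℝ) ^ γ := by
      have h4 := Real.rpow_le_rpow (Real.rpow_nonneg (le_max_right _ _) _) h1 hγ.le
      rwa [Real.rpow_inv_rpow (le_max_right _ _) hγ.ne'] at h4
    have h5 : T ≤ (m : ℝ) ^ γ := (le_max_left _ _).trans h3
    rw [hT, div_le_iff₀ hC₂] at h5
    linarith
  -- the small-`m` rates
  set W1 : ℕ → ℝ := fun m => (Fintype.card {p : stdCay.Walk 1 1 // p.length = m} : ℝ) with hW1
  set rate : ℕ → ℝ := fun m => if m = 0 ∨ W1 m = 0 then C₂ / 2 else -Real.log (W1 m / 4 ^ m) / (m : ℝ) ^ γ with hrate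
  have hrate_pos : ∀ m, 0 < rate m := by
    intro m
    simp only [hrate]
    split_ifs with h
    · positivity
    · push Not at h
      have hm1 : 1 ≤ m := Nat.one_le_iff_ne_zero.2 h.1
      have hlt := card_closedWalks_stdCay_lt_pow 1 m hm1
      have hW0 : 0 < W1 m := lt_of_le_of_ne (Nat.cast_nonneg _) (Ne.symm h.2)
      have hratio : W1 m / 4 ^ m < 1 := by
        rw [div_lt_one (by positivity)]
        have : (Fintype.card {p : stdCay.Walk 1 1 // p.length = m} : ℝ) + 1 ≤ (4 : ℝ) ^ m := by exact_mod_cast hlt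
        simp only [hW1]; linarith
      have hlog : Real.log (W1 m / 4 ^ m) < 0 := Real.log_neg (by positivity) hratio
      have hmγ : 0 < (m : ℝ) ^ γ := Real.rpow_pos_of_pos (by exact_mod_cast hm1) _
      exact div_pos (by linarith) hmγ
  -- `c` = the least of `C₂/2` and the small-`m` rates
  obtain ⟨c, hc, hcC, hcrate⟩ : ∃ c : ℝ, 0 < c ∧ c ≤ C₂ / 2 ∧ ∀ m, m < m₀ → c ≤ rate m := by
    have hne : (Finset.range m₀).Nonempty := ⟨0, Finset.mem_range.2 (by simp [hm₀])⟩
    obtain ⟨m', hm', hinf⟩ := Finset.exists_mem_eq_inf' hne rate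
    refine ⟨min (C₂ / 2) ((Finset.range m₀).inf' hne rate), lt_min (by positivity) (by rw [hinf]; exact hrate_pos m'),
      min_le_left _ _, fun m hm => (min_le_right _ _).trans (Finset.inf'_le rate (Finset.mem_range.2 hm))⟩
  refine ⟨c, γ, hc, hγ, hγ1, fun v m => ?_⟩
  by_cases hm : m₀ ≤ m
  · -- large `m`
    refine (hdec' v m).trans ?_
    have hpos : (0 : ℝ) < 4 ^ m := by positivity
    rw [show C₁ * (4 : ℝ) ^ m * Real.exp (-(C₂ * (m : ℝ) ^ γ)) = 4 ^ m * (C₁ * Real.exp (-(C₂ * (m : ℝ) ^ γ))) by ring]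
    refine mul_le_mul_of_nonneg_left ?_ hpos.le
    rw [← Real.exp_log hC₁, ← Real.exp_add, Real.exp_le_exp]
    have hmγ : 0 ≤ (m : ℝ) ^ γ := Real.rpow_nonneg (Nat.cast_nonneg m) _
    nlinarith [hlarge m hm, hcC]
  · -- small `m`: compare with the count at the identity
    push Not at hm
    have hle : (Fintype.card {p : stdCay.Walk v v // p.length = m} : ℝ) ≤ W1 m := by
      simp only [hW1]; exact_mod_cast card_closedWalks_stdCay_le_one v m
    refine hle.trans ?_
    have hcm := hcrate m hm
    simp only [hrate] at hcm
    by_cases h0 : m = 0 ∨ W1 m = 0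
    · rcases h0 with rfl | h0
      · simp [hW1, card_walks_zero, Real.zero_rpow hγ.ne']
      · rw [h0]; positivity
    · rw [if_neg h0] at hcm
      push Not at h0
      have hm1 : 1 ≤ m := Nat.one_le_iff_ne_zero.2 h0.1
      have hW0 : 0 < W1 m := lt_of_le_of_ne (Nat.cast_nonneg _) (Ne.symm h0.2)
      have hmγ : 0 < (m : ℝ) ^ γ := Real.rpow_pos_of_pos (by exact_mod_cast hm1) _
      have hpos : (0 : ℝ) < 4 ^ m := by positivity
      -- `W1 m = 4^m exp(log (W1 m / 4^m)) ≤ 4^m exp(-c m^γ)`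
      have e : W1 m = 4 ^ m * Real.exp (Real.log (W1 m / 4 ^ m)) := by
        rw [Real.exp_log (by positivity)]; field_simp
      rw [e]
      refine mul_le_mul_of_nonneg_left (Real.exp_le_exp.2 ?_) hpos.le
      rw [le_div_iff₀ hmγ] at hcm
      linarith

/-! ## §3 The `k`-uniform return decay on `Cay(𝔊^k; std)` -/

/-- **`k`-UNIFORM STRETCHED-EXPONENTIAL RETURN DECAY on `Cay(𝔊^k; std)`, closed-walk-count currency** (modulo Woess 2000 Cor. 14.5(b) on the base graph only):
`∃ c γ, 0 < c, 0 < γ ≤ 1, ∀ k v j, W_{𝔊^k}(j)(v, v) ≤ (4k)^j · exp(−c·j^γ)` — the product formula's bound form (p688765 `card_closedWalks_gkCay_le`) with the normalised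
base bound `b(m) = exp(−c m^γ)`: `∏_i b(N_i) = exp(−c Σ_i N_i^γ) ≤ exp(−c j^γ)` (subadditivity, `Σ_i N_i = j`; the unused coordinates `N_i = 0` contribute exactly `1`,
which is where the normalisation `C₁ = 1` is load-bearing), summed over the `k^j` allocations.  CONDITIONAL only on `hW`; nothing about `θ(p_c)`.
[cite: Woess2000, §1.B, Cor. 14.5(b)] [cite: HeydenreichVanDerHofstad2017, §5.2] -/
theorem card_closedWalks_gkCay_le_exp (hW : Woess2000_closedWalks_decay_of_growth) :
    ∃ c γ : ℝ, 0 < c ∧ 0 < γ ∧ γ ≤ 1 ∧ ∀ (k : ℕ) (v : GPow k) (j : ℕ),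
      (Fintype.card {p : (gkCay k).Walk v v // p.length = j} : ℝ) ≤ (4 * (k : ℝ)) ^ j * Real.exp (-(c * (j : ℝ) ^ γ)) := by
  obtain ⟨c, γ, hc, hγ, hγ1, hbase⟩ := stdCay_closedWalks_decay_normalised hW
  refine ⟨c, γ, hc, hγ, hγ1, fun k v j => ?_⟩
  -- the product formula's bound form with `b(m) = exp(-c m^γ)`
  have hW := card_closedWalks_gkCay_le k j v (fun m => Real.exp (-(c * (m : ℝ) ^ γ))) fun m x => hbase x m
  -- each allocation contributes at most `exp(-c j^γ)`
  have halloc : ∀ f : Fin j → Fin k, ∏ i : Fin k, Real.exp (-(c * (((Finset.univ.filter fun t => f t = i).card : ℕ) : ℝ) ^ γ)) ≤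
      Real.exp (-(c * (j : ℝ) ^ γ)) := by
    intro f
    rw [← Real.exp_sum, Real.exp_le_exp, Finset.sum_neg_distrib, neg_le_neg_iff, ← Finset.mul_sum]
    refine mul_le_mul_of_nonneg_left ?_ hc.le
    have hj : (j : ℝ) = ∑ i : Fin k, (((Finset.univ.filter fun t => f t = i).card : ℕ) : ℝ) := by
      rw [← Nat.cast_sum, sum_card_filter_eq]
    rw [hj]
    exact rpow_sum_le_sum_rpow _ _ (fun _ => Nat.cast_nonneg _) hγ hγ1
  calc (Fintype.card {p : (gkCay k).Walk v v // p.length = j} : ℝ)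
      ≤ 4 ^ j * ∑ f : Fin j → Fin k, ∏ i : Fin k, Real.exp (-(c * (((Finset.univ.filter fun t => f t = i).card : ℕ) : ℝ) ^ γ)) := hW
    _ ≤ 4 ^ j * ((k : ℝ) ^ j * Real.exp (-(c * (j : ℝ) ^ γ))) := by
        refine mul_le_mul_of_nonneg_left ?_ (by positivity)
        calc ∑ f : Fin j → Fin k, ∏ i : Fin k, Real.exp (-(c * (((Finset.univ.filter fun t => f t = i).card : ℕ) : ℝ) ^ γ))
            ≤ ∑ _f : Fin j → Fin k, Real.exp (-(c * (j : ℝ) ^ γ)) := Finset.sum_le_sum fun f _ => halloc f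
          _ = (k : ℝ) ^ j * Real.exp (-(c * (j : ℝ) ^ γ)) := by
              rw [Finset.sum_const, Finset.card_univ, Fintype.card_fun, Fintype.card_fin, Fintype.card_fin, nsmul_eq_mul]
              push_cast; ring
    _ = (4 * (k : ℝ)) ^ j * Real.exp (-(c * (j : ℝ) ^ γ)) := by ring

/-- **`k`-UNIFORM STRETCHED-EXPONENTIAL RETURN DECAY of the simple random walk on `Cay(𝔊^k; std)`** (modulo Woess 2000 Cor. 14.5(b) on the base graph only):
`∃ c γ, 0 < c, 0 < γ ≤ 1, ∀ k ≥ 1, ∀ v j, p^{(k)}_j(v, v) ≤ exp(−c·j^γ)` — `card_closedWalks_gkCay_le_exp` divided by `(4k)^j` (E4.1 `simpleStep_eq_card_walks_div`).  The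
`k`-uniformity device of the W4 line (Woess ONCE on the base, transfer through the product formula); CONDITIONAL only on `hW`; nothing about `θ(p_c)`.
[cite: Woess2000, §1.B, Cor. 14.5(b)] [cite: HeydenreichVanDerHofstad2017, §5.2] -/
theorem simpleStep_gkCay_self_le_exp (hW : Woess2000_closedWalks_decay_of_growth) :
    ∃ c γ : ℝ, 0 < c ∧ 0 < γ ∧ γ ≤ 1 ∧ ∀ k : ℕ, 1 ≤ k → ∀ (v : GPow k) (j : ℕ),
      simpleStep (gkCay k) j v v ≤ Real.exp (-(c * (j : ℝ) ^ γ)) := by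
  obtain ⟨c, γ, hc, hγ, hγ1, hcount⟩ := card_closedWalks_gkCay_le_exp hW
  refine ⟨c, γ, hc, hγ, hγ1, fun k hk v j => ?_⟩
  have hkpos : (0 : ℝ) < (k : ℝ) := by exact_mod_cast hk
  have hd : 0 < 4 * k := by omega
  obtain ⟨W, hWdef, hWle⟩ : ∃ W : ℝ, (Fintype.card {p : (gkCay k).Walk v v // p.length = j} : ℝ) = W ∧
      W ≤ (4 * (k : ℝ)) ^ j * Real.exp (-(c * (j : ℝ) ^ γ)) := ⟨_, rfl, hcount k v j⟩
  rw [simpleStep_eq_card_walks_div (gkCay k) (gkCay_isRegularOfDegree k) hd j v v, hWdef, div_le_iff₀ (by positivity)]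
  calc W ≤ (4 * (k : ℝ)) ^ j * Real.exp (-(c * (j : ℝ) ^ γ)) := hWle
    _ = Real.exp (-(c * (j : ℝ) ^ γ)) * (((4 * k : ℕ) : ℝ)) ^ j := by push_cast; ring

end NcHaraSlade

end Grigorchuk

end Summit.CriticalPhenomena.PercolationContinuityZ3.Theorems.Transplant

end
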